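import Literature.MathematicalPhysics.QuantumFieldTheory.Balaban1983to89.Beta.DecimatedMoment
import Literature.MathematicalPhysics.QuantumFieldTheory.Balaban1983to89.B12Sec2to5

/-!
# Beta/DecimatedMomentLimit — the passage `T ↗ ℤ^d` in the KERNEL slot of the windowed dressed-moment identities of
`Beta/DecimatedMoment`: the nine-term master identity holds POINTWISE in the fine variable, hence passes to infinitely
extended kernels `T` under nothing more than the summability of the four `T`-moment families

HONEST FRAMING (cell `pub-balaban`; B12 paper sub-cell, row b2b-balaban-b12-g11, journal claim BETA-b12-O1-TWINDOW).
The β sub-cell tries to discharge the one-loop input of [Balaban1987RG1] Theorem 2; that would make Bałaban's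
ultraviolet STABILITY theorem unconditional in the glossed sense recorded in `Beta/StrangFixAlias` (Gloss 1 / Gloss 2:
NOT «Theorem 2 as printed», never the continuum limit / mass gap / Clay).  This file is far less: it removes ONE
finiteness idealisation from the kernel-checked bookkeeping identity behind the cell's reading of (1.22) — the finite
window `ST` of the dressed kernel's middle factor `T` — and nothing else.  Value = kernel limit-passage leaf, NOT summit
progress.  THIS MODULE DISCHARGES NOTHING of the series; nothing printed in [Balaban1987RG1] is used as a fact.

CONTEXT (internal records, not literature, not used as facts).  `Beta/DecimatedMoment` (an2 lineage) proves, for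
FINITE index windows `Sw, ST, Sx ⊂ ℤ^d`, the identity `wsum_master_nine`: the `χ`-windowed second moment of the
two-sided dressed sum `Σ_{u∈Sw} Σ_{t∈ST} Σ_{x∈Sx} χ(t+x−u)(t+x−u)_κ(t+x−u)_λ • (w u · T t · w' x)` equals a nine-term
combination of plain moments of `T` over `ST` and of `w'` over `Sx`, under the reproduction hypotheses (L0), (L1) on
`w` and (R0) on `w'` and NO hypothesis on `T`; with (T0), (T1) it collapses to `σ · M2_{κλ}(T) · M0(w')`
(`wsum_second_of_vanishing`).  The cell's records (HOME/BETA/AN2.md §11 (Y5); HOME/BETA-SPEC.md §7.19 (R11-2)) list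
among the inputs standing between that identity and the printed object the passage **(O1) «T ↗ ℤ⁴»**: in print the
kernel is defined through an infinite-volume limit and is infinitely extended with exponential decay, whereas the
identity is finite-window — «routine, definition road, unowned in the kernel».  This file makes the `T`-window part
of that passage a theorem.  THE OBSERVATION: `wsum_master_nine` holds for EVERY finite `ST`, in particular for the
singletons `ST = {t}`; so the nine-term identity holds POINTWISE for the fine-point integrand
`slice … t = Σ_{u∈Sw} Σ_{x∈Sx} (χ(t+x−u) · g u t x) • (w u · T t · w' x)` (§1), and every mode of summation in
`t` is inherited term by term.  For unconditional summation on `ℤ^d` (Mathlib's `HasSum`: convergence of the net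
of finite partial sums, i.e. LITERALLY «the window `ST` exhausts `ℤ^d`») this gives §2: if the four families `T`,
`t_κ • T`, `t_λ • T`, `(t_κ t_λ) • T` have sums `m₀, m₁κ, m₁λ, m₂`, the windowed dressed second moment has the sum
obtained from the nine-term right member by `fmom ST (…) T ↦ m…` — equivalently
`Tendsto (fun ST => wsum χ Sw ST Sx w T w' g₂) atTop (𝓝 …)` — and `σ · m₂ · M0(w')` under the infinite (T0), (T1)
(`m₀ = m₁κ = m₁λ = 0`).  No absolute convergence, no decay rate and no domination is needed for this slot: the
integrand IS the nine-term integrand.  §3 restates the result for the cell's `Finsupp` patterns with the coset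
window (`DecimatedMoment.ConstRepro` / `LinRepro`, as consumed through `Beta/StrangFixAlias`) and regroups the sum
by the COARSE output point `y = t + x − u` (the literal shape `Σ_y χ(y) y_κ y_λ K(y)` of a windowed second moment of
the dressed kernel `K(y) = Σ_{u,x} w u · T(y+u−x) · w' x`) under slice-wise summability; §4 discharges every
summability hypothesis over `ℝ` from the typed decay shape (5.10) of the B12 §2–5 module (`B12Sec2to5.Decay510`,
b03 lineage) and lands on the typed right member of (1.22), `B12Beta.secondMoment`.

WHAT IS IN PRINT (context locators only; quotations as already carried verbatim by `Beta/InfiniteVolume`,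
`B12Beta`, `B12Sec2to5`).  [Balaban1987RG1] p. 264 [PDF 16], before (1.22): «Now we take a limit of these functions
as T^{(j+1)} ↗ Z^d. This limit exists by the localized representation (1.7).»; (1.22): «… =
Σ_x Π_{j+1,μν}(g_j, x) x_μ x_ν (1.22) for μ, ν arbitrary, μ ≠ ν» (typed `B12Beta.secondMoment`, a `tsum` over `ℤ^d`);
p. 292 [PDF 44], (5.1): «Π(b, b′) = lim_{T_1^{(j)} ↗ Z^4} …»; p. 293 [PDF 45], (5.10): «|Π_{μν}(x − y)| ≦ O(1)E₀
exp(−δ₁|x − y|)» (typed `B12Sec2to5.Decay510`).  Nothing of this is asserted here; the dressed/decimated reading of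
Π is the cell's typing (D-a) (AN2 §11), not print's wording.

WHAT THIS FILE PROVES (all [folklore]; `R` any ring; from §2 on a topological ring, Hausdorff where `∑'` appears):
* §1 `slice`, `wsum_eq_sum_slice` (`wsum` over `ST` = `Σ_{t∈ST} slice t`), `wsum_singleton`, `fmom_singleton`, and the
  POINTWISE master identities `slice_zero_eq`, `slice_first_eq`, `slice_second_eq` (from an2's `wsum_zero_master`,
  `wsum_first_master`, `wsum_master_nine` at `ST = {t}`);
* §2 `hasSum_slice_zero / _first / _second` (the sums under `HasSum` hypotheses on the `T`-families),
  `tendsto_wsum_second` (the window form `ST ↗ ℤ^d` along `Filter.atTop` on `Finset (Fin d → ℤ)`),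
  `hasSum_slice_second_of_vanishing` / `tsum_slice_second_of_vanishing` (infinite (T0), (T1) ⟹
  `σ · m₂ · fmom Sx 1 w'`), `summable_slice_second`; and the CONSISTENCY CHECK `hasSum_moment_of_support_subset`:
  for a kernel vanishing off a finite `ST` the hypotheses hold with the finite moments `fmom ST (…) T`, so the
  statement restricts to an2's;
* §3 `dressed` (the two-sided dressed kernel as a function of the coarse output point), `hasSum_slice_translate`,
  `hasSum_regroup` / `hasSum_slice_of_slicewise` / `tsum_regroup` (whenever every `(u, x)`-slice is summable,
  `Σ_y (χ y · φ y) • dressed y` and `Σ_t slice t` both have the sum `Σ_{u,x} Σ'_t (slice term)` — translation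
  `y = t + x − u` slice by slice, `Equiv.hasSum_iff` + `hasSum_sum` — hence equal `tsum`s), and the
  `ConstRepro`/`LinRepro` forms `decimated_second_moment_hasSum` / `_tsum` / `_tendsto` for `w w' : LatFun d R`,
  window `cosetInd N`, infinitely extended `T`; CONSISTENCY WITH an2's `Finsupp` OBJECT (v1.1): for a finitely
  supported `T : LatFun d R`, `tsum_coarse_eq_moment` (`Σ'_y (χ y · φ y) • dressed y` is LITERALLY
  `moment (χ·φ) (conv (conv (reflect w) T) w')`, via an2's `wsum_eq_moment`) and `tsum_coarse_eq_of_finsupp` (the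
  infinite-volume statement gives back `DecimatedMoment.windowed_second_moment_dressed`'s value `σ · M2 κ λ T · M0 w'`);
  DECIMATION AS REINDEXING (v1.1, any topological `R`, `N ≠ 0`): `cosetInd_zsmul`, `cosetInd_eq_zero_of_not_mem_range`,
  `dilate_injective`, `hasSum_decimate_iff` / `tsum_decimate` (a `cosetInd N`-windowed sum over `ℤ^d` = the sum
  over the coarse lattice `y = N • z`; `Function.Injective.hasSum_iff` / `.tsum_eq`, no summability hypothesis),
  `weight_zsmul` (`(N•z)_κ(N•z)_λ = N²·z_κ z_λ`);
* §4 over `ℝ`: `summable_weight_mul_of_decay510` (ENGINE: a weight of at most quadratic growth times a kernel with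
  the (5.10)-shape decay, rate `δ₁ > 0`, is summable; from b03's `B12Sec2to5.summable_exp_neg_l1`,
  `majorant_summable`), its instances `summable_of_decay510`, `summable_coord_mul_of_decay510`,
  `summable_coord2_mul_of_decay510`, `summable_slice_term_of_decay510` (with `l1_add_le`,
  `abs_cosetInd_le_one`), then `decimated_second_moment_of_decay510` (the identity over all of `ℤ^d`, fine-point
  AND coarse-point form, every summability discharged) and `decimated_second_moment_eq_secondMoment` (right member
  `σ · B12Beta.secondMoment P μ ν · M0 w'` for a component kernel `T = P μ ν` with infinite (T0), (T1)); v1.1: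
  `decimated_second_moment_of_decay510_coarse` (the same sum read on the coarse lattice: `HasSum` of
  `z ↦ (N²·z_κ z_λ) • dressed (N • z)`).

WHAT THIS FILE DOES NOT DO.  The PATTERN slots stay finitely supported: `w` over `Sw`, `w'` over `Sx` with (L0), (L1),
(R0) exactly as in `Beta/DecimatedMoment` (for Bałaban's minimisers the response patterns are themselves infinitely
extended — B11 (190) —; passing to the limit in those slots needs absolute summability of all three factors and a
`tsum` form of (L0)/(L1), not done here); nothing about the operators' thermodynamic limit ((O1′) of AN2 §11 (Y13));
nothing about (H-aff)_k, (Q-aff), (I4′); no identification of `T` with Bałaban's kernel.  Labels: [folklore] =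
elementary algebra / elementary topology of infinite sums, proved here in full; no cited facts are used.

Version v1 (2026-08-19, b2b-balaban-b12-g11, p182336).  v1.1 (same seat): APPEND-ONLY — new `section Decimate`
(reindexing over the coarse lattice) and `section ConsistencyFinsupp` (`tsum_coarse_eq_moment`,
`tsum_coarse_eq_of_finsupp`) inside §3, `decimated_second_moment_of_decay510_coarse` in §4, and the matching header
bullets; every v1 declaration byte-identical.  value = kernel limit-passage leaf, NOT summit progress.
-/

namespace Literature.MathematicalPhysics.QuantumFieldTheory.Balaban1983to89.Beta.DecimatedMomentLimit

open Finset Filter Topology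
open DecimatedMoment

variable {d : ℕ} {R : Type*} [Ring R]

/-! ## §1 The fine-point integrand and the pointwise master identities -/

/-- The `(u, x)`-summed integrand of `DecimatedMoment.wsum` at the fine point `t`:
`slice χ Sw Sx w T w' g t = Σ_{u∈Sw} Σ_{x∈Sx} (χ(t+x−u) · g u t x) • (w u · T t · w' x)`. [folklore] -/
def slice (χ : (Fin d → ℤ) → ℤ) (Sw Sx : Finset (Fin d → ℤ)) (w T w' : (Fin d → ℤ) → R)
    (g : (Fin d → ℤ) → (Fin d → ℤ) → (Fin d → ℤ) → ℤ) (t : Fin d → ℤ) : R :=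
  ∑ u ∈ Sw, ∑ x ∈ Sx, (χ (t + x - u) * g u t x) • (w u * T t * w' x)

section Algebra

variable (χ : (Fin d → ℤ) → ℤ) (Sw Sx : Finset (Fin d → ℤ)) (w T w' : (Fin d → ℤ) → R)

/-- The windowed dressed sum over the `T`-window `ST` is the sum of the slices over `ST`. [folklore] -/
theorem wsum_eq_sum_slice (ST : Finset (Fin d → ℤ)) (g : (Fin d → ℤ) → (Fin d → ℤ) → (Fin d → ℤ) → ℤ) :
    wsum χ Sw ST Sx w T w' g = ∑ t ∈ ST, slice χ Sw Sx w T w' g t := by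
  unfold wsum slice
  exact Finset.sum_comm

/-- The singleton window: `wsum` over `ST = {t}` is the slice at `t`. [folklore] -/
theorem wsum_singleton (g : (Fin d → ℤ) → (Fin d → ℤ) → (Fin d → ℤ) → ℤ) (t : Fin d → ℤ) :
    wsum χ Sw {t} Sx w T w' g = slice χ Sw Sx w T w' g t := by
  rw [wsum_eq_sum_slice, Finset.sum_singleton]

/-- A finite moment over a singleton. [folklore] -/
theorem fmom_singleton (a : (Fin d → ℤ) → ℤ) (f : (Fin d → ℤ) → R) (t : Fin d → ℤ) :
    fmom {t} a f = a t • f t := by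
  unfold fmom
  rw [Finset.sum_singleton]

/-- **Pointwise zeroth identity** ((L0) only): `slice 1 t = σ · T t · M0(w')`. [folklore] -/
theorem slice_zero_eq {σ : R} (hL0 : ∀ a, ∑ u ∈ Sw, χ (a - u) • w u = σ) (t : Fin d → ℤ) :
    slice χ Sw Sx w T w' (fun _ _ _ => 1) t = σ * T t * fmom Sx (fun _ => 1) w' := by
  rw [← wsum_singleton, wsum_zero_master χ Sw {t} Sx w T w' hL0, fmom_singleton, one_smul]

/-- **Pointwise first identity** ((L0), (L1)):
`slice (t+x−u)_κ t = σ·(t_κ • T t)·M0(w') + σ·T t·M1_κ(w') − C_κ·T t·M0(w')`. [folklore] -/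
theorem slice_first_eq {σ : R} {C : Fin d → R} (hL0 : ∀ a, ∑ u ∈ Sw, χ (a - u) • w u = σ)
    (hL1 : ∀ a κ, ∑ u ∈ Sw, (χ (a - u) * u κ) • w u = C κ) (κ : Fin d) (t : Fin d → ℤ) :
    slice χ Sw Sx w T w' (fun u t x => (t + x - u) κ) t
      = σ * (t κ • T t) * fmom Sx (fun _ => 1) w'
        + σ * T t * fmom Sx (fun x => x κ) w'
        - C κ * T t * fmom Sx (fun _ => 1) w' := by
  rw [← wsum_singleton, wsum_first_master χ Sw {t} Sx w T w' hL0 hL1 κ, fmom_singleton, fmom_singleton,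
    one_smul]

/-- **Pointwise nine-term identity** ((L0), (L1), (R0); NO hypothesis on `T`): the slice of the windowed second
moment at the fine point `t` is an2's nine-term right member with `fmom ST a T` replaced by `a t • T t`. [folklore] -/
theorem slice_second_eq {σ σ' : R} {C : Fin d → R} (hL0 : ∀ a, ∑ u ∈ Sw, χ (a - u) • w u = σ)
    (hL1 : ∀ a κ, ∑ u ∈ Sw, (χ (a - u) * u κ) • w u = C κ)
    (hR0 : ∀ a, ∑ x ∈ Sx, χ (x - a) • w' x = σ') (κ l : Fin d) (t : Fin d → ℤ) :
    slice χ Sw Sx w T w' (fun u t x => (t + x - u) κ * (t + x - u) l) t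
      = σ * ((t κ * t l) • T t) * fmom Sx (fun _ => 1) w'
        + σ * (t κ • T t) * fmom Sx (fun x => x l) w'
        + σ * (t l • T t) * fmom Sx (fun x => x κ) w'
        - C l * (t κ • T t) * fmom Sx (fun _ => 1) w'
        - C κ * (t l • T t) * fmom Sx (fun _ => 1) w'
        + σ * T t * fmom Sx (fun x => x κ * x l) w'
        - C l * T t * fmom Sx (fun x => x κ) w'
        - C κ * T t * fmom Sx (fun x => x l) w'
        + fmom Sw (fun u => u κ * u l) w * T t * σ' := by
  rw [← wsum_singleton, wsum_master_nine χ Sw {t} Sx w T w' hL0 hL1 hR0 κ l, fmom_singleton, fmom_singleton,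
    fmom_singleton, fmom_singleton, one_smul]

end Algebra

/-! ## §2 The passage `ST ↗ ℤ^d`: sums of the slices under `HasSum` hypotheses on the `T`-moment families -/

section Limit

variable [TopologicalSpace R] [IsTopologicalRing R]
variable (χ : (Fin d → ℤ) → ℤ) (Sw Sx : Finset (Fin d → ℤ)) (w T w' : (Fin d → ℤ) → R)

/-- Zeroth order: if `Σ_t T t = m₀` then the windowed dressed ZEROTH moment over all of `ℤ^d` is `σ · m₀ · M0(w')`.
[folklore] -/
theorem hasSum_slice_zero {σ : R} (hL0 : ∀ a, ∑ u ∈ Sw, χ (a - u) • w u = σ) {m₀ : R} (h0 : HasSum T m₀) :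
    HasSum (slice χ Sw Sx w T w' (fun _ _ _ => 1)) (σ * m₀ * fmom Sx (fun _ => 1) w') := by
  have e : slice χ Sw Sx w T w' (fun _ _ _ => 1) = fun t => σ * T t * fmom Sx (fun _ => 1) w' :=
    funext (slice_zero_eq χ Sw Sx w T w' hL0)
  rw [e]
  exact (h0.mul_left σ).mul_right _

/-- First order: with `Σ_t T t = m₀`, `Σ_t t_κ • T t = m₁`, the windowed dressed FIRST moment over `ℤ^d` is
`σ·m₁·M0(w') + σ·m₀·M1_κ(w') − C_κ·m₀·M0(w')`. [folklore] -/
theorem hasSum_slice_first {σ : R} {C : Fin d → R} (hL0 : ∀ a, ∑ u ∈ Sw, χ (a - u) • w u = σ)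
    (hL1 : ∀ a κ, ∑ u ∈ Sw, (χ (a - u) * u κ) • w u = C κ) (κ : Fin d) {m₀ m₁ : R}
    (h0 : HasSum T m₀) (h1 : HasSum (fun t => t κ • T t) m₁) :
    HasSum (slice χ Sw Sx w T w' (fun u t x => (t + x - u) κ))
      (σ * m₁ * fmom Sx (fun _ => 1) w' + σ * m₀ * fmom Sx (fun x => x κ) w'
        - C κ * m₀ * fmom Sx (fun _ => 1) w') := by
  have e : slice χ Sw Sx w T w' (fun u t x => (t + x - u) κ)
      = fun t => σ * (t κ • T t) * fmom Sx (fun _ => 1) w' + σ * T t * fmom Sx (fun x => x κ) w'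
          - C κ * T t * fmom Sx (fun _ => 1) w' :=
    funext (slice_first_eq χ Sw Sx w T w' hL0 hL1 κ)
  rw [e]
  exact (((h1.mul_left σ).mul_right _).add ((h0.mul_left σ).mul_right _)).sub ((h0.mul_left (C κ)).mul_right _)

/-- **SECOND ORDER — THE PASSAGE.**  Under (L0), (L1), (R0) (finite pattern windows) and the existence of the four
sums `Σ_t T t = m₀`, `Σ_t t_κ • T t = m₁κ`, `Σ_t t_λ • T t = m₁λ`, `Σ_t (t_κ t_λ) • T t = m₂` (unconditional
summation on `ℤ^d`; no absolute convergence assumed), the `χ`-windowed second moment of the dressed sum with the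
INFINITELY EXTENDED kernel `T` has the sum given by an2's nine-term right member with the infinite `T`-moments.
[folklore] -/
theorem hasSum_slice_second {σ σ' : R} {C : Fin d → R} (hL0 : ∀ a, ∑ u ∈ Sw, χ (a - u) • w u = σ)
    (hL1 : ∀ a κ, ∑ u ∈ Sw, (χ (a - u) * u κ) • w u = C κ)
    (hR0 : ∀ a, ∑ x ∈ Sx, χ (x - a) • w' x = σ') (κ l : Fin d) {m₀ m₁κ m₁l m₂ : R}
    (h0 : HasSum T m₀) (h1κ : HasSum (fun t => t κ • T t) m₁κ) (h1l : HasSum (fun t => t l • T t) m₁l)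
    (h2 : HasSum (fun t => (t κ * t l) • T t) m₂) :
    HasSum (slice χ Sw Sx w T w' (fun u t x => (t + x - u) κ * (t + x - u) l))
      (σ * m₂ * fmom Sx (fun _ => 1) w'
        + σ * m₁κ * fmom Sx (fun x => x l) w'
        + σ * m₁l * fmom Sx (fun x => x κ) w'
        - C l * m₁κ * fmom Sx (fun _ => 1) w'
        - C κ * m₁l * fmom Sx (fun _ => 1) w'
        + σ * m₀ * fmom Sx (fun x => x κ * x l) w'
        - C l * m₀ * fmom Sx (fun x => x κ) w'
        - C κ * m₀ * fmom Sx (fun x => x l) w'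
        + fmom Sw (fun u => u κ * u l) w * m₀ * σ') := by
  have e : slice χ Sw Sx w T w' (fun u t x => (t + x - u) κ * (t + x - u) l)
      = fun t => σ * ((t κ * t l) • T t) * fmom Sx (fun _ => 1) w'
        + σ * (t κ • T t) * fmom Sx (fun x => x l) w'
        + σ * (t l • T t) * fmom Sx (fun x => x κ) w'
        - C l * (t κ • T t) * fmom Sx (fun _ => 1) w'
        - C κ * (t l • T t) * fmom Sx (fun _ => 1) w'
        + σ * T t * fmom Sx (fun x => x κ * x l) w'
        - C l * T t * fmom Sx (fun x => x κ) w'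
        - C κ * T t * fmom Sx (fun x => x l) w'
        + fmom Sw (fun u => u κ * u l) w * T t * σ' :=
    funext (slice_second_eq χ Sw Sx w T w' hL0 hL1 hR0 κ l)
  rw [e]
  exact (((((((((h2.mul_left σ).mul_right _).add ((h1κ.mul_left σ).mul_right _)).add
    ((h1l.mul_left σ).mul_right _)).sub ((h1κ.mul_left (C l)).mul_right _)).sub
    ((h1l.mul_left (C κ)).mul_right _)).add ((h0.mul_left σ).mul_right _)).sub
    ((h0.mul_left (C l)).mul_right _)).sub ((h0.mul_left (C κ)).mul_right _)).add
    ((h0.mul_left (fmom Sw (fun u => u κ * u l) w)).mul_right σ')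

/-- **THE WINDOW FORM «`ST ↗ ℤ^d`»**: the finite-window second moments `wsum χ Sw ST Sx w T w' g₂` of
`Beta/DecimatedMoment` CONVERGE, along the net of finite windows `ST` directed by inclusion (`Filter.atTop` on
`Finset (Fin d → ℤ)`), to the sum of `hasSum_slice_second`. [folklore] -/
theorem tendsto_wsum_second {σ σ' : R} {C : Fin d → R} (hL0 : ∀ a, ∑ u ∈ Sw, χ (a - u) • w u = σ)
    (hL1 : ∀ a κ, ∑ u ∈ Sw, (χ (a - u) * u κ) • w u = C κ)
    (hR0 : ∀ a, ∑ x ∈ Sx, χ (x - a) • w' x = σ') (κ l : Fin d) {m₀ m₁κ m₁l m₂ : R}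
    (h0 : HasSum T m₀) (h1κ : HasSum (fun t => t κ • T t) m₁κ) (h1l : HasSum (fun t => t l • T t) m₁l)
    (h2 : HasSum (fun t => (t κ * t l) • T t) m₂) :
    Tendsto (fun ST => wsum χ Sw ST Sx w T w' (fun u t x => (t + x - u) κ * (t + x - u) l)) atTop
      (𝓝 (σ * m₂ * fmom Sx (fun _ => 1) w'
        + σ * m₁κ * fmom Sx (fun x => x l) w'
        + σ * m₁l * fmom Sx (fun x => x κ) w'
        - C l * m₁κ * fmom Sx (fun _ => 1) w'
        - C κ * m₁l * fmom Sx (fun _ => 1) w'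
        + σ * m₀ * fmom Sx (fun x => x κ * x l) w'
        - C l * m₀ * fmom Sx (fun x => x κ) w'
        - C κ * m₀ * fmom Sx (fun x => x l) w'
        + fmom Sw (fun u => u κ * u l) w * m₀ * σ')) := by
  have h : Tendsto (fun ST : Finset (Fin d → ℤ) =>
      ∑ t ∈ ST, slice χ Sw Sx w T w' (fun u t x => (t + x - u) κ * (t + x - u) l) t) atTop (𝓝 _) :=
    hasSum_slice_second χ Sw Sx w T w' hL0 hL1 hR0 κ l h0 h1κ h1l h2
  exact h.congr (fun ST => (wsum_eq_sum_slice χ Sw Sx w T w' ST _).symm)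

/-- Under the INFINITE (T0), (T1) — `Σ_t T t = 0`, `Σ_t t_κ • T t = 0 = Σ_t t_λ • T t` — the windowed dressed second
moment over `ℤ^d` is `σ · m₂ · M0(w')`: dressing-and-decimation does not change the second moment, now for an
infinitely extended kernel. [folklore] -/
theorem hasSum_slice_second_of_vanishing {σ σ' : R} {C : Fin d → R} (hL0 : ∀ a, ∑ u ∈ Sw, χ (a - u) • w u = σ)
    (hL1 : ∀ a κ, ∑ u ∈ Sw, (χ (a - u) * u κ) • w u = C κ)
    (hR0 : ∀ a, ∑ x ∈ Sx, χ (x - a) • w' x = σ') (κ l : Fin d) {m₂ : R}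
    (hT0 : HasSum T 0) (hT1κ : HasSum (fun t => t κ • T t) 0) (hT1l : HasSum (fun t => t l • T t) 0)
    (hT2 : HasSum (fun t => (t κ * t l) • T t) m₂) :
    HasSum (slice χ Sw Sx w T w' (fun u t x => (t + x - u) κ * (t + x - u) l))
      (σ * m₂ * fmom Sx (fun _ => 1) w') := by
  have h := hasSum_slice_second χ Sw Sx w T w' hL0 hL1 hR0 κ l hT0 hT1κ hT1l hT2
  simpa only [mul_zero, zero_mul, add_zero, sub_zero] using h

/-- The slice family of the windowed second moment is (unconditionally) summable under the four hypotheses — a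
CONSEQUENCE of the identity, not an extra assumption. [folklore] -/
theorem summable_slice_second {σ σ' : R} {C : Fin d → R} (hL0 : ∀ a, ∑ u ∈ Sw, χ (a - u) • w u = σ)
    (hL1 : ∀ a κ, ∑ u ∈ Sw, (χ (a - u) * u κ) • w u = C κ)
    (hR0 : ∀ a, ∑ x ∈ Sx, χ (x - a) • w' x = σ') (κ l : Fin d)
    (h0 : Summable T) (h1κ : Summable (fun t => t κ • T t)) (h1l : Summable (fun t => t l • T t))
    (h2 : Summable (fun t => (t κ * t l) • T t)) :
    Summable (slice χ Sw Sx w T w' (fun u t x => (t + x - u) κ * (t + x - u) l)) :=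
  (hasSum_slice_second χ Sw Sx w T w' hL0 hL1 hR0 κ l h0.hasSum h1κ.hasSum h1l.hasSum h2.hasSum).summable

/-- `tsum` form of the vanishing case (Hausdorff `R`): `Σ'_t slice t = σ · (Σ'_t (t_κ t_λ) • T t) · M0(w')`.
[folklore] -/
theorem tsum_slice_second_of_vanishing [T2Space R] {σ σ' : R} {C : Fin d → R}
    (hL0 : ∀ a, ∑ u ∈ Sw, χ (a - u) • w u = σ)
    (hL1 : ∀ a κ, ∑ u ∈ Sw, (χ (a - u) * u κ) • w u = C κ)
    (hR0 : ∀ a, ∑ x ∈ Sx, χ (x - a) • w' x = σ') (κ l : Fin d)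
    (hT0 : HasSum T 0) (hT1κ : HasSum (fun t => t κ • T t) 0) (hT1l : HasSum (fun t => t l • T t) 0)
    (hT2 : Summable (fun t => (t κ * t l) • T t)) :
    ∑' t, slice χ Sw Sx w T w' (fun u t x => (t + x - u) κ * (t + x - u) l) t
      = σ * (∑' t, (t κ * t l) • T t) * fmom Sx (fun _ => 1) w' :=
  (hasSum_slice_second_of_vanishing χ Sw Sx w T w' hL0 hL1 hR0 κ l hT0 hT1κ hT1l hT2.hasSum).tsum_eq

end Limit

section Consistency

variable [TopologicalSpace R] (T : (Fin d → ℤ) → R)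

/-- CONSISTENCY CHECK with the finite statement: for a kernel vanishing off a finite set `ST` the four hypotheses of
`hasSum_slice_second` hold with the finite moments `fmom ST (…) T` (in any topology), so the infinite statement
restricts to an2's `wsum_master_nine` read through `wsum_eq_sum_slice`. [folklore] -/
theorem hasSum_moment_of_support_subset (ST : Finset (Fin d → ℤ)) (hT : ∀ t ∉ ST, T t = 0)
    (a : (Fin d → ℤ) → ℤ) : HasSum (fun t => a t • T t) (fmom ST a T) := by
  unfold fmom
  exact hasSum_sum_of_ne_finset_zero (fun t ht => by rw [hT t ht, smul_zero])

end Consistency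

/-! ## §3 Regrouping by the coarse output point, and the `ConstRepro` / `LinRepro` forms -/

section Regroup

variable (Sw Sx : Finset (Fin d → ℤ)) (w T w' : (Fin d → ℤ) → R)

/-- The two-sided DRESSED KERNEL as a function of the coarse output point `y = t + x − u`:
`dressed Sw Sx w T w' y = Σ_{u∈Sw} Σ_{x∈Sx} w u · T (y + u − x) · w' x` (cf. the finite-support two-sided
convolution `conv (conv (reflect w) T) w'` of `MomentFactorisation`, whose windowed moments an2's
`DecimatedMoment.wsum_eq_moment` expresses through `wsum`; no identification with it is needed or proved here);
`T` is any function `ℤ^d → R`. [folklore] -/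
def dressed (y : Fin d → ℤ) : R := ∑ u ∈ Sw, ∑ x ∈ Sx, w u * T (y + u - x) * w' x

variable [TopologicalSpace R] [IsTopologicalRing R]
variable (χ : (Fin d → ℤ) → ℤ)

omit [IsTopologicalRing R] in
/-- The sum of one `(u, x)`-slice, TRANSLATED to the coarse output variable `y = t + x − u`. [folklore] -/
theorem hasSum_slice_translate (φ : (Fin d → ℤ) → ℤ) {u x : Fin d → ℤ} {a : R}
    (h : HasSum (fun t => (χ (t + x - u) * φ (t + x - u)) • (w u * T t * w' x)) a) :
    HasSum (fun y => (χ y * φ y) • (w u * T (y + u - x) * w' x)) a := by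
  have h' := ((Equiv.addRight (u - x)).hasSum_iff).mpr h
  have e : (fun y => (χ y * φ y) • (w u * T (y + u - x) * w' x))
      = (fun t => (χ (t + x - u) * φ (t + x - u)) • (w u * T t * w' x)) ∘ ⇑(Equiv.addRight (u - x)) := by
    funext y
    have e1 : y + (u - x) = y + u - x := by abel
    have e2 : y + u - x + x - u = y := by abel
    simp only [Function.comp_apply, Equiv.coe_addRight, e1, e2]
  rw [e]
  exact h'

/-- **REGROUPING `t ↦ y = t + x − u`.**  If every `(u, x)`-slice family
`t ↦ (χ(t+x−u) · φ(t+x−u)) • (w u · T t · w' x)` is summable, the coarse-point family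
`y ↦ (χ y · φ y) • dressed y` has the sum `Σ_{u∈Sw} Σ_{x∈Sx} Σ'_t (slice term)` (translation slice by slice,
`Equiv.hasSum_iff`, then finite recombination, `hasSum_sum`). [folklore] -/
theorem hasSum_regroup (φ : (Fin d → ℤ) → ℤ)
    (hF : ∀ u ∈ Sw, ∀ x ∈ Sx, Summable (fun t => (χ (t + x - u) * φ (t + x - u)) • (w u * T t * w' x))) :
    HasSum (fun y => (χ y * φ y) • dressed Sw Sx w T w' y)
      (∑ u ∈ Sw, ∑ x ∈ Sx, ∑' t, (χ (t + x - u) * φ (t + x - u)) • (w u * T t * w' x)) := by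
  have e : (fun y => (χ y * φ y) • dressed Sw Sx w T w' y)
      = fun y => ∑ u ∈ Sw, ∑ x ∈ Sx, (χ y * φ y) • (w u * T (y + u - x) * w' x) := by
    funext y
    simp only [dressed, Finset.smul_sum]
  rw [e]
  exact hasSum_sum (fun u hu => hasSum_sum (fun x hx =>
    hasSum_slice_translate w T w' χ φ (hF u hu x hx).hasSum))

/-- … and so does the fine-point family `t ↦ slice t` (finite recombination only). [folklore] -/
theorem hasSum_slice_of_slicewise (φ : (Fin d → ℤ) → ℤ)
    (hF : ∀ u ∈ Sw, ∀ x ∈ Sx, Summable (fun t => (χ (t + x - u) * φ (t + x - u)) • (w u * T t * w' x))) :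
    HasSum (slice χ Sw Sx w T w' (fun u t x => φ (t + x - u)))
      (∑ u ∈ Sw, ∑ x ∈ Sx, ∑' t, (χ (t + x - u) * φ (t + x - u)) • (w u * T t * w' x)) := by
  unfold slice
  exact hasSum_sum (fun u hu => hasSum_sum (fun x hx => (hF u hu x hx).hasSum))

/-- Hence (Hausdorff `R`) the COARSE-POINT windowed moment `Σ'_y (χ y · φ y) • dressed y` EQUALS the fine-point sum
`Σ'_t slice t` — the literal shape of a `χ`-windowed moment of the dressed kernel, as in
`DecimatedMoment.wsum_eq_moment`, now with an infinitely extended `T`. [folklore] -/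
theorem tsum_regroup [T2Space R] (φ : (Fin d → ℤ) → ℤ)
    (hF : ∀ u ∈ Sw, ∀ x ∈ Sx, Summable (fun t => (χ (t + x - u) * φ (t + x - u)) • (w u * T t * w' x))) :
    ∑' y, (χ y * φ y) • dressed Sw Sx w T w' y
      = ∑' t, slice χ Sw Sx w T w' (fun u t x => φ (t + x - u)) t := by
  rw [(hasSum_regroup Sw Sx w T w' χ φ hF).tsum_eq, (hasSum_slice_of_slicewise Sw Sx w T w' χ φ hF).tsum_eq]

end Regroup

section Decimate

variable [TopologicalSpace R]

/-- The coset window is `1` on the sublattice `N•ℤ^d`. [folklore] -/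
theorem cosetInd_zsmul (N : ℕ) (z : Fin d → ℤ) : cosetInd N ((N : ℤ) • z) = 1 := by
  unfold cosetInd
  rw [if_pos]
  intro i
  exact ⟨z i, by simp only [Pi.smul_apply, smul_eq_mul]⟩

/-- … and `0` off it (`N ≠ 0`): a point all of whose coordinates are divisible by `N` is `N • (y / N)`. [folklore] -/
theorem cosetInd_eq_zero_of_not_mem_range (N : ℕ) {y : Fin d → ℤ}
    (hy : y ∉ Set.range (fun z : Fin d → ℤ => (N : ℤ) • z)) : cosetInd N y = 0 := by
  unfold cosetInd
  rw [if_neg]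
  intro h
  apply hy
  refine ⟨fun i => y i / N, funext (fun i => ?_)⟩
  simp only [Pi.smul_apply, smul_eq_mul]
  exact Int.mul_ediv_cancel' (h i)

/-- Dilation `z ↦ N • z` is injective for `N ≠ 0`. [folklore] -/
theorem dilate_injective {N : ℕ} (hN : N ≠ 0) :
    Function.Injective (fun z : Fin d → ℤ => (N : ℤ) • z) := by
  intro a b h
  funext i
  have hi := congr_fun h i
  simp only [Pi.smul_apply, smul_eq_mul] at hi
  exact mul_left_cancel₀ (by exact_mod_cast hN) hi

/-- **DECIMATION = REINDEXING OVER THE COARSE LATTICE** (`N ≠ 0`): a `cosetInd N`-windowed sum over `ℤ^d` is the sum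
over the coarse lattice points `y = N • z` — `HasSum` form (no summability hypothesis: `Function.Injective.hasSum_iff`).
[folklore] -/
theorem hasSum_decimate_iff {N : ℕ} (hN : N ≠ 0) (φ : (Fin d → ℤ) → ℤ) (K : (Fin d → ℤ) → R) (a : R) :
    HasSum (fun z : Fin d → ℤ => φ ((N : ℤ) • z) • K ((N : ℤ) • z)) a
      ↔ HasSum (fun y => (cosetInd N y * φ y) • K y) a := by
  have h := (dilate_injective (d := d) hN).hasSum_iff (f := fun y => (cosetInd N y * φ y) • K y) (a := a)
    (fun y hy => by rw [cosetInd_eq_zero_of_not_mem_range N hy, zero_mul, zero_smul])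
  rw [← h]
  refine Iff.of_eq (congrArg (fun f => HasSum f a) (funext (fun z => ?_)))
  simp only [Function.comp_apply, cosetInd_zsmul, one_mul]

/-- `tsum` form of the decimation reindexing. [folklore] -/
theorem tsum_decimate {N : ℕ} (hN : N ≠ 0) (φ : (Fin d → ℤ) → ℤ) (K : (Fin d → ℤ) → R) :
    ∑' y, (cosetInd N y * φ y) • K y = ∑' z : Fin d → ℤ, φ ((N : ℤ) • z) • K ((N : ℤ) • z) := by
  have h := (dilate_injective (d := d) hN).tsum_eq (f := fun y => (cosetInd N y * φ y) • K y)
    (fun y hy => by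
      by_contra hr
      exact hy (show (cosetInd N y * φ y) • K y = 0 by
        rw [cosetInd_eq_zero_of_not_mem_range N hr, zero_mul, zero_smul]))
  rw [← h]
  exact tsum_congr (fun z => by simp only [cosetInd_zsmul, one_mul])

/-- The second-moment weight on the coarse lattice: `(N•z)_κ (N•z)_λ = N² · z_κ z_λ`. [folklore] -/
theorem weight_zsmul (N : ℕ) (z : Fin d → ℤ) (κ l : Fin d) :
    ((N : ℤ) • z) κ * ((N : ℤ) • z) l = (N : ℤ) ^ 2 * (z κ * z l) := by
  simp only [Pi.smul_apply, smul_eq_mul]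
  ring

end Decimate

section Coset

open MomentFactorisation

variable [TopologicalSpace R] [IsTopologicalRing R]

/-- **THE `ConstRepro` / `LinRepro` FORM** (the hypotheses exactly as consumed through `Beta/StrangFixAlias`:
finitely supported patterns `w, w' : LatFun d R`, window `cosetInd N` of the sublattice `N•ℤ^d`) with an
INFINITELY EXTENDED kernel `T : ℤ^d → R` obeying the infinite (T0), (T1) and having a second moment `m₂`:
the `N•ℤ^d`-windowed second moment of the dressed sum over ALL of `ℤ^d` is `σ · m₂ · M0(w')`. [folklore] -/
theorem decimated_second_moment_hasSum (N : ℕ) (w w' : LatFun d R) (T : (Fin d → ℤ) → R) {σ σ' : R}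
    {C : Fin d → R} (hw : ConstRepro N w σ) (hw' : LinRepro N w C) (hR : ConstRepro N w' σ') (κ l : Fin d)
    {m₂ : R} (hT0 : HasSum T 0) (hT1κ : HasSum (fun t => t κ • T t) 0) (hT1l : HasSum (fun t => t l • T t) 0)
    (hT2 : HasSum (fun t => (t κ * t l) • T t) m₂) :
    HasSum (slice (cosetInd N) w.support w'.support ⇑w T ⇑w' (fun u t x => (t + x - u) κ * (t + x - u) l))
      (σ * m₂ * M0 w') := by
  rw [M0_eq_fmom]
  exact hasSum_slice_second_of_vanishing (cosetInd N) w.support w'.support ⇑w T ⇑w'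
    ((constRepro_iff N w σ).1 hw) ((linRepro_iff N w C).1 hw') ((constRepro_iff_right N w' σ').1 hR) κ l
    hT0 hT1κ hT1l hT2

/-- `tsum` form (Hausdorff `R`). [folklore] -/
theorem decimated_second_moment_tsum [T2Space R] (N : ℕ) (w w' : LatFun d R) (T : (Fin d → ℤ) → R)
    {σ σ' : R} {C : Fin d → R} (hw : ConstRepro N w σ) (hw' : LinRepro N w C) (hR : ConstRepro N w' σ')
    (κ l : Fin d) (hT0 : HasSum T 0) (hT1κ : HasSum (fun t => t κ • T t) 0)
    (hT1l : HasSum (fun t => t l • T t) 0) (hT2 : Summable (fun t => (t κ * t l) • T t)) :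
    ∑' t, slice (cosetInd N) w.support w'.support ⇑w T ⇑w' (fun u t x => (t + x - u) κ * (t + x - u) l) t
      = σ * (∑' t, (t κ * t l) • T t) * M0 w' :=
  (decimated_second_moment_hasSum N w w' T hw hw' hR κ l hT0 hT1κ hT1l hT2.hasSum).tsum_eq

/-- The windowed second moment of the dressed sum, in the finite-window form of `Beta/DecimatedMoment`, converges
along `ST ↗ ℤ^d` to `σ · m₂ · M0(w')` (`ConstRepro` / `LinRepro` form). [folklore] -/
theorem decimated_second_moment_tendsto (N : ℕ) (w w' : LatFun d R) (T : (Fin d → ℤ) → R) {σ σ' : R}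
    {C : Fin d → R} (hw : ConstRepro N w σ) (hw' : LinRepro N w C) (hR : ConstRepro N w' σ') (κ l : Fin d)
    {m₂ : R} (hT0 : HasSum T 0) (hT1κ : HasSum (fun t => t κ • T t) 0) (hT1l : HasSum (fun t => t l • T t) 0)
    (hT2 : HasSum (fun t => (t κ * t l) • T t) m₂) :
    Tendsto (fun ST => wsum (cosetInd N) w.support ST w'.support ⇑w T ⇑w'
      (fun u t x => (t + x - u) κ * (t + x - u) l)) atTop (𝓝 (σ * m₂ * M0 w')) := by
  have h : Tendsto (fun ST : Finset (Fin d → ℤ) => ∑ t ∈ ST, slice (cosetInd N) w.support w'.support ⇑w T ⇑w'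
      (fun u t x => (t + x - u) κ * (t + x - u) l) t) atTop (𝓝 _) :=
    decimated_second_moment_hasSum N w w' T hw hw' hR κ l hT0 hT1κ hT1l hT2
  exact h.congr (fun ST => (wsum_eq_sum_slice _ _ _ _ _ _ ST _).symm)

end Coset

section ConsistencyFinsupp

open MomentFactorisation

variable [TopologicalSpace R] [IsTopologicalRing R] [T2Space R]

/-- **CONSISTENCY WITH an2's `Finsupp` OBJECT.**  For a FINITELY supported kernel `T : LatFun d R` every slice is
finitely supported, and the coarse-point windowed moment of §3 summed over all of `ℤ^d` is LITERALLY an2's windowed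
moment `moment (χ·φ) (conv (conv (reflect w) T) w')` of the two-sided convolution (`DecimatedMoment.wsum_eq_moment`
read through `tsum_regroup` and `wsum_eq_sum_slice`): the infinite statements of this file restrict to the finite
ones. [folklore] -/
theorem tsum_coarse_eq_moment (χ φ : (Fin d → ℤ) → ℤ) (w T w' : LatFun d R) :
    ∑' y, (χ y * φ y) • dressed w.support w'.support ⇑w ⇑T ⇑w' y
      = moment (fun y => χ y * φ y) (conv (conv (reflect w) T) w') := by
  have hF : ∀ u ∈ w.support, ∀ x ∈ w'.support,
      Summable (fun t => (χ (t + x - u) * φ (t + x - u)) • (w u * T t * w' x)) := by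
    intro u _ x _
    refine summable_of_ne_finset_zero (s := T.support) (fun t ht => ?_)
    rw [Finsupp.notMem_support_iff.1 ht, mul_zero, zero_mul, smul_zero]
  have hslice : ∀ t ∉ T.support, slice χ w.support w'.support ⇑w ⇑T ⇑w' (fun u t x => φ (t + x - u)) t = 0 := by
    intro t ht
    unfold slice
    refine Finset.sum_eq_zero (fun u _ => Finset.sum_eq_zero (fun x _ => ?_))
    rw [Finsupp.notMem_support_iff.1 ht, mul_zero, zero_mul, smul_zero]
  rw [tsum_regroup w.support w'.support ⇑w ⇑T ⇑w' χ φ hF, tsum_eq_sum hslice,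
    ← wsum_eq_sum_slice χ w.support w'.support ⇑w ⇑T ⇑w' T.support (fun u t x => φ (t + x - u))]
  exact wsum_eq_moment χ φ w T w'

/-- … in particular (window `cosetInd N`, weight `y_κ y_λ`, (T0), (T1) as finite moments): the infinite-volume
statement gives back `DecimatedMoment.windowed_second_moment_dressed`'s value `σ · M2 κ λ T · M0 w'`. [folklore] -/
theorem tsum_coarse_eq_of_finsupp (N : ℕ) (w T w' : LatFun d R) {σ σ' : R} {C : Fin d → R}
    (hw : ConstRepro N w σ) (hw' : LinRepro N w C) (hR : ConstRepro N w' σ') (κ l : Fin d)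
    (hT0 : M0 T = 0) (hT1κ : M1 κ T = 0) (hT1l : M1 l T = 0) :
    ∑' y, (cosetInd N y * (y κ * y l)) • dressed w.support w'.support ⇑w ⇑T ⇑w' y = σ * M2 κ l T * M0 w' := by
  rw [tsum_coarse_eq_moment (cosetInd N) (fun y => y κ * y l) w T w']
  exact windowed_second_moment_dressed (cosetInd N) w T w' ((constRepro_iff N w σ).1 hw)
    ((linRepro_iff N w C).1 hw') ((constRepro_iff_right N w' σ').1 hR) κ l hT0 hT1κ hT1l

end ConsistencyFinsupp

/-! ## §4 Over `ℝ`: every summability hypothesis from the (5.10)-shape decay; the typed right member of (1.22) -/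

section RealDecay

open MomentFactorisation B12Sec2to5

/-- `|x|₁` is subadditive. [folklore] -/
theorem l1_add_le (t c : Fin d → ℤ) : l1 (t + c) ≤ l1 t + l1 c := by
  unfold l1
  rw [← Finset.sum_add_distrib]
  refine Finset.sum_le_sum (fun μ _ => ?_)
  rw [Pi.add_apply, Int.cast_add]
  exact abs_add_le _ _

/-- The coset window takes values in `{0, 1}`: `|cosetInd N z| ≤ 1`. [folklore] -/
theorem abs_cosetInd_le_one (N : ℕ) (z : Fin d → ℤ) : |(cosetInd N z : ℝ)| ≤ 1 := by
  unfold cosetInd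
  split_ifs <;> simp

/-- **ENGINE.**  A weight of at most quadratic growth in `|t|₁` times a kernel with the (5.10)-shape decay
(`Decay510 T C δ₁`, `δ₁ > 0`) is summable on `ℤ^d` — dominated by `B(1+|t|₁²)·C e^{−δ₁|t|₁}`, summable by b03's
`summable_exp_neg_l1` and `majorant_summable`. [folklore] -/
theorem summable_weight_mul_of_decay510 {T : (Fin d → ℤ) → ℝ} {C δ₁ : ℝ} (hδ : 0 < δ₁) (h : Decay510 T C δ₁)
    {a : (Fin d → ℤ) → ℝ} {B : ℝ} (ha : ∀ t, |a t| ≤ B * (1 + l1 t ^ 2)) :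
    Summable (fun t => a t * T t) := by
  have hg : Summable (fun t : Fin d → ℤ => B * (1 + l1 t ^ 2) * (C * Real.exp (-δ₁ * l1 t))) := by
    have hs := ((summable_exp_neg_l1 hδ d).add (majorant_summable hδ d)).mul_left (B * C)
    refine hs.congr (fun t => ?_)
    ring
  refine Summable.of_norm_bounded hg (fun t => ?_)
  rw [Real.norm_eq_abs, abs_mul]
  exact mul_le_mul (ha t) (h t) (abs_nonneg _) ((abs_nonneg _).trans (ha t))

/-- (5.10)-decay ⟹ `T` is summable. [folklore] -/
theorem summable_of_decay510 {T : (Fin d → ℤ) → ℝ} {C δ₁ : ℝ} (hδ : 0 < δ₁) (h : Decay510 T C δ₁) :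
    Summable T := by
  have hs := summable_weight_mul_of_decay510 hδ h (a := fun _ => (1 : ℝ)) (B := 1)
    (fun t => by rw [abs_one, one_mul]; nlinarith [sq_nonneg (l1 t)])
  simpa only [one_mul] using hs

/-- (5.10)-decay ⟹ the first-moment family `t_κ · T t` is summable. [folklore] -/
theorem summable_coord_mul_of_decay510 {T : (Fin d → ℤ) → ℝ} {C δ₁ : ℝ} (hδ : 0 < δ₁) (h : Decay510 T C δ₁)
    (κ : Fin d) : Summable (fun t => (t κ : ℝ) * T t) :=
  summable_weight_mul_of_decay510 hδ h (B := 1) (fun t => by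
    rw [one_mul]
    have h1 := abs_coord_le_l1 t κ
    nlinarith [sq_nonneg (2 * l1 t - 1)])

/-- (5.10)-decay ⟹ the second-moment family `t_κ t_λ · T t` is summable. [folklore] -/
theorem summable_coord2_mul_of_decay510 {T : (Fin d → ℤ) → ℝ} {C δ₁ : ℝ} (hδ : 0 < δ₁) (h : Decay510 T C δ₁)
    (κ l : Fin d) : Summable (fun t => (t κ : ℝ) * (t l : ℝ) * T t) :=
  summable_weight_mul_of_decay510 hδ h (B := 1) (fun t => by
    rw [one_mul, abs_mul]
    have hm : |(t κ : ℝ)| * |(t l : ℝ)| ≤ l1 t * l1 t :=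
      mul_le_mul (abs_coord_le_l1 t κ) (abs_coord_le_l1 t l) (abs_nonneg _) (l1_nonneg t)
    nlinarith [hm])

/-- (5.10)-decay ⟹ every `(u, x)`-slice family of a windowed second moment (window bounded by `1` in absolute
value) is summable — the hypothesis of the regrouping `hasSum_regroup`. [folklore] -/
theorem summable_slice_term_of_decay510 {T : (Fin d → ℤ) → ℝ} {C δ₁ : ℝ} (hδ : 0 < δ₁) (h : Decay510 T C δ₁)
    (χ : (Fin d → ℤ) → ℤ) (hχ : ∀ z, |(χ z : ℝ)| ≤ 1) (w w' : (Fin d → ℤ) → ℝ) (κ l : Fin d)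
    (u x : Fin d → ℤ) :
    Summable (fun t => (χ (t + x - u) * ((t + x - u) κ * (t + x - u) l)) • (w u * T t * w' x)) := by
  have hmain : Summable (fun t =>
      ((χ (t + x - u) * ((t + x - u) κ * (t + x - u) l) : ℤ) : ℝ) * (w u * w' x) * T t) := by
    refine summable_weight_mul_of_decay510 hδ h (B := 2 * (1 + l1 (x - u) ^ 2) * |w u * w' x|) (fun t => ?_)
    have hc1 := abs_coord_le_l1 (t + x - u) κ
    have hc2 := abs_coord_le_l1 (t + x - u) l
    have htri : l1 (t + x - u) ≤ l1 t + l1 (x - u) := by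
      have := l1_add_le t (x - u)
      rwa [← add_sub_assoc] at this
    have hs0 := l1_nonneg (t + x - u)
    have ht0 := l1_nonneg t
    have hc0 := l1_nonneg (x - u)
    have hχc : |(χ (t + x - u) : ℝ)| * (|((t + x - u) κ : ℝ)| * |((t + x - u) l : ℝ)|) ≤ l1 (t + x - u) ^ 2 :=
      calc |(χ (t + x - u) : ℝ)| * (|((t + x - u) κ : ℝ)| * |((t + x - u) l : ℝ)|)
          ≤ 1 * (l1 (t + x - u) * l1 (t + x - u)) :=
            mul_le_mul (hχ _) (mul_le_mul hc1 hc2 (abs_nonneg _) hs0) (by positivity) zero_le_one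
        _ = l1 (t + x - u) ^ 2 := by ring
    have hsq : l1 (t + x - u) ^ 2 ≤ (l1 t + l1 (x - u)) ^ 2 := pow_le_pow_left₀ hs0 htri 2
    have hsq' : (l1 t + l1 (x - u)) ^ 2 ≤ 2 * (1 + l1 (x - u) ^ 2) * (1 + l1 t ^ 2) := by
      nlinarith [sq_nonneg (l1 t - l1 (x - u)), sq_nonneg (l1 t * l1 (x - u)), sq_nonneg (l1 t),
        sq_nonneg (l1 (x - u))]
    rw [Int.cast_mul, Int.cast_mul, abs_mul, abs_mul, abs_mul]
    calc |(χ (t + x - u) : ℝ)| * (|((t + x - u) κ : ℝ)| * |((t + x - u) l : ℝ)|) * |w u * w' x|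
        ≤ (2 * (1 + l1 (x - u) ^ 2) * (1 + l1 t ^ 2)) * |w u * w' x| :=
          mul_le_mul_of_nonneg_right ((hχc.trans hsq).trans hsq') (abs_nonneg _)
      _ = 2 * (1 + l1 (x - u) ^ 2) * |w u * w' x| * (1 + l1 t ^ 2) := by ring
  refine hmain.congr (fun t => ?_)
  rw [zsmul_eq_mul]
  ring

/-- **(5.10) ⟹ THE IDENTITY, both in the fine-point and in the coarse-point (literal windowed-moment) form.**
Patterns `w, w' : LatFun d ℝ` with `ConstRepro`/`LinRepro` (window `N•ℤ^d`), kernel `T : ℤ^d → ℝ` with the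
(5.10)-shape decay and the infinite (T0), (T1) (`Σ' T = 0`, `Σ' t_κ T = Σ' t_λ T = 0`): the `N•ℤ^d`-windowed second
moment of the dressed kernel over all of `ℤ^d` equals `σ · (Σ'_t T t · t_κ · t_λ) · M0(w')` — all sums exist,
by §4's engine; right member in the literal integrand order of `B12Beta.secondMoment`. [folklore] -/
theorem decimated_second_moment_of_decay510 (N : ℕ) (w w' : LatFun d ℝ) (T : (Fin d → ℤ) → ℝ) {σ σ' : ℝ}
    {C' : Fin d → ℝ} (hw : ConstRepro N w σ) (hw' : LinRepro N w C') (hR : ConstRepro N w' σ') (κ l : Fin d)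
    {C δ₁ : ℝ} (hδ : 0 < δ₁) (hT : Decay510 T C δ₁)
    (hT0 : ∑' t, T t = 0) (hT1κ : ∑' t, (t κ : ℝ) * T t = 0) (hT1l : ∑' t, (t l : ℝ) * T t = 0) :
    HasSum (slice (cosetInd N) w.support w'.support ⇑w T ⇑w' (fun u t x => (t + x - u) κ * (t + x - u) l))
        (σ * (∑' t, T t * (t κ : ℝ) * (t l : ℝ)) * M0 w')
      ∧ HasSum (fun y => (cosetInd N y * (y κ * y l)) • dressed w.support w'.support ⇑w T ⇑w' y)
        (σ * (∑' t, T t * (t κ : ℝ) * (t l : ℝ)) * M0 w') := by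
  -- the four `HasSum` hypotheses of §2/§3, from decay + the vanishing `tsum`s
  have h0 : HasSum T 0 := by
    have := (summable_of_decay510 hδ hT).hasSum
    rwa [hT0] at this
  have e1 : ∀ μ : Fin d, (fun t : Fin d → ℤ => t μ • T t) = fun t => (t μ : ℝ) * T t :=
    fun μ => funext (fun t => zsmul_eq_mul _ _)
  have h1 : ∀ μ : Fin d, ∑' t, (t μ : ℝ) * T t = 0 → HasSum (fun t : Fin d → ℤ => t μ • T t) 0 := by
    intro μ hμ
    rw [e1 μ]
    have := (summable_coord_mul_of_decay510 hδ hT μ).hasSum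
    rwa [hμ] at this
  have e2 : (fun t : Fin d → ℤ => (t κ * t l) • T t) = fun t => (t κ : ℝ) * (t l : ℝ) * T t :=
    funext (fun t => by rw [zsmul_eq_mul, Int.cast_mul])
  have h2 : HasSum (fun t : Fin d → ℤ => (t κ * t l) • T t) (∑' t, T t * (t κ : ℝ) * (t l : ℝ)) := by
    rw [e2, tsum_congr (fun t => show T t * (t κ : ℝ) * (t l : ℝ) = (t κ : ℝ) * (t l : ℝ) * T t by ring)]
    exact (summable_coord2_mul_of_decay510 hδ hT κ l).hasSum
  have A := decimated_second_moment_hasSum N w w' T hw hw' hR κ l h0 (h1 κ hT1κ) (h1 l hT1l) h2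
  refine ⟨A, ?_⟩
  -- coarse-point form: regroup slice by slice (every slice summable by the engine) and identify the value
  have hF : ∀ u ∈ w.support, ∀ x ∈ w'.support, Summable (fun t =>
      (cosetInd N (t + x - u) * ((t + x - u) κ * (t + x - u) l)) • (w u * T t * w' x)) :=
    fun u _ x _ => summable_slice_term_of_decay510 hδ hT (cosetInd N) (abs_cosetInd_le_one N) ⇑w ⇑w' κ l u x
  have B := hasSum_slice_of_slicewise w.support w'.support ⇑w T ⇑w' (cosetInd N) (fun y => y κ * y l) hF
  have B' := hasSum_regroup w.support w'.support ⇑w T ⇑w' (cosetInd N) (fun y => y κ * y l) hF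
  rw [← B.unique A]
  exact B'

/-- **COARSE-LATTICE FORM** (the shape in which a windowed second moment is read as a second moment of the
DECIMATED kernel `z ↦ dressed (N • z)` on the coarse lattice, weight `(N•z)_κ(N•z)_λ = N²·z_κ z_λ`; `N ≠ 0`):
same hypotheses, same value. [folklore] -/
theorem decimated_second_moment_of_decay510_coarse {N : ℕ} (hN : N ≠ 0) (w w' : LatFun d ℝ)
    (T : (Fin d → ℤ) → ℝ) {σ σ' : ℝ} {C' : Fin d → ℝ} (hw : ConstRepro N w σ) (hw' : LinRepro N w C')
    (hR : ConstRepro N w' σ') (κ l : Fin d) {C δ₁ : ℝ} (hδ : 0 < δ₁) (hT : Decay510 T C δ₁)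
    (hT0 : ∑' t, T t = 0) (hT1κ : ∑' t, (t κ : ℝ) * T t = 0) (hT1l : ∑' t, (t l : ℝ) * T t = 0) :
    HasSum (fun z : Fin d → ℤ =>
        ((N : ℤ) ^ 2 * (z κ * z l)) • dressed w.support w'.support ⇑w T ⇑w' ((N : ℤ) • z))
      (σ * (∑' t, T t * (t κ : ℝ) * (t l : ℝ)) * M0 w') := by
  have h := (hasSum_decimate_iff hN (fun y => y κ * y l) (dressed w.support w'.support ⇑w T ⇑w') _).2
    (decimated_second_moment_of_decay510 N w w' T hw hw' hR κ l hδ hT hT0 hT1κ hT1l).2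
  refine h.congr_fun (fun z => ?_)
  simp only [weight_zsmul]

/-- **THE TYPED RIGHT MEMBER OF (1.22).**  For a component kernel `T = P μ ν` of a `B12Beta.Kernel` obeying (5.10)
and the infinite (T0), (T1): the `N•ℤ^d`-windowed second `(μ, ν)`-moment of the dressed kernel over all of `ℤ^d`
is `σ · B12Beta.secondMoment P μ ν · M0(w')` — `secondMoment` being the literal typing of the right member
`Σ_x Π_{μν}(x) x_μ x_ν` of (1.22) = (5.42).  (Consistency of the cell's decimated/dressed reading (D-a) of Π with the
printed number, at the level of the limit object; nothing of Bałaban's is asserted.) [folklore] -/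
theorem decimated_second_moment_eq_secondMoment (N : ℕ) (w w' : LatFun d ℝ) (P : B12Beta.Kernel d) (μ ν : Fin d)
    {σ σ' : ℝ} {C' : Fin d → ℝ} (hw : ConstRepro N w σ) (hw' : LinRepro N w C') (hR : ConstRepro N w' σ')
    {C δ₁ : ℝ} (hδ : 0 < δ₁) (hT : Decay510 (P μ ν) C δ₁) (hT0 : ∑' t, P μ ν t = 0)
    (hT1μ : ∑' t, (t μ : ℝ) * P μ ν t = 0) (hT1ν : ∑' t, (t ν : ℝ) * P μ ν t = 0) :
    ∑' y, (cosetInd N y * (y μ * y ν)) • dressed w.support w'.support ⇑w (P μ ν) ⇑w' y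
      = σ * B12Beta.secondMoment P μ ν * M0 w' :=
  (decimated_second_moment_of_decay510 N w w' (P μ ν) hw hw' hR μ ν hδ hT hT0 hT1μ hT1ν).2.tsum_eq

end RealDecay

end Literature.MathematicalPhysics.QuantumFieldTheory.Balaban1983to89.Beta.DecimatedMomentLimit
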